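import Mathlib
import HarnessLib
import Literature.MathematicalPhysics.QuantumLattice.GrassmannPairLaplacians
import Literature.MathematicalPhysics.QuantumLattice.GrassmannKernelExpansion
import Literature.MathematicalPhysics.QuantumLattice.GrassmannLaplacianPairWick

/-!
# The two-point function of a Grassmann Gaussian integral with an even interaction, in terms of the
# quadratic kernel of the Wilsonian effective action (child 4 `KLRegimeTwoPointAssembly` of crux K3, stub `stub_asm_repr`)

Generic finite-dimensional identity (any covariance `C`, any even interaction `V` without constant part whose normalised
partition function `Z = ∫ dμ_C e^{-V}` is a unit):

  `∫ dμ_C ψ(a) ψ(b) e^{-V} = Z · ( A(a,b) + Σ_{Y,Z} A(a,Y) A(b,Z) · constPart (∂_Z ∂_Y 𝒢) )`,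

`A = contr C` the free two-point function (`A(X,Y) = ∫ dμ_C ψ(X)ψ(Y)`), `𝒢 = effAction C V` (Salmhofer 1999 (4.72)/(4.85):
`μ_C ⋆ e^{-V} = Z e^{-𝒢}`), `constPart (∂_Z ∂_Y 𝒢) = 2 · kernel 𝒢 2 (Y, Z)`: the interacting two-point function is the free
one plus the free propagators dressing the two-leg kernel of the (fully integrated) effective action.  Integration by parts
twice (`gaussExpect_gen_mul`), derivatives commute with the Gaussian convolution, and for an even `𝒢` without constant
part only the linear term of `e^{-𝒢}` has a two-point coefficient.
-/

noncomputable section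

namespace Summit.HubbardSuperconductivity.HubbardSuperconductivity.Theorems.TwoPointAssembly

set_option linter.dupNamespace false -- summit = problem name (single-conjunct summit), D-0017

open Literature.MathematicalPhysics.QuantumLattice GrassmannAlgebra Finset

variable (R : Type*) [CommRing R] [Algebra ℚ R] {Γ : Type*} [Fintype Γ] [DecidableEq Γ]

/-- **Integration by parts, twice**: `∫ dμ_C ψ(a)ψ(b) F = A(a,b) ∫ dμ_C F − Σ_{Y,Z} A(a,Y) A(b,Z) ∫ dμ_C ∂_Z ∂_Y F`,
`A = contr C`. -/
theorem gaussExpect_gen_mul_gen_mul (C : Matrix Γ Γ R) (a b : Γ) (F : GrassmannAlgebra R Γ) :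
    gaussExpect R C (gen R a * gen R b * F) =
      contr R C a b * gaussExpect R C F -
        ∑ Y, ∑ Z, contr R C a Y * contr R C b Z * gaussExpect R C (grassmannDeriv R Z (grassmannDeriv R Y F)) := by
  rw [mul_assoc, gaussExpect_gen_mul]
  have hY : ∀ Y, gaussExpect R C (grassmannDeriv R Y (gen R b * F)) =
      (if Y = b then gaussExpect R C F else 0) - ∑ Z, contr R C b Z * gaussExpect R C (grassmannDeriv R Z (grassmannDeriv R Y F)) := by
    intro Y
    rw [grassmannDeriv_gen_mul, map_sub, gaussExpect_gen_mul]
    congr 1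
    · split_ifs <;> simp
  simp only [← contr_apply]
  simp only [hY, mul_sub, mul_ite, mul_zero, Finset.sum_sub_distrib, Finset.sum_ite_eq', Finset.mem_univ,
    if_true, Finset.mul_sum, mul_assoc]

omit [DecidableEq Γ] in
/-- Derivatives commute with the Gaussian expectation's convolution:
`∫ dμ_C ∂_Z ∂_Y F = constPart (∂_Z ∂_Y (μ_C ⋆ F))`. -/
theorem gaussExpect_grassmannDeriv_grassmannDeriv (C : Matrix Γ Γ R) (Y Z : Γ) (F : GrassmannAlgebra R Γ) :
    gaussExpect R C (grassmannDeriv R Z (grassmannDeriv R Y F)) =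
      constPart R (grassmannDeriv R Z (grassmannDeriv R Y (gaussConv R C F))) := by
  rw [gaussExpect_apply, ← grassmannDeriv_gaussConv, ← grassmannDeriv_gaussConv]

omit [DecidableEq Γ] [Algebra ℚ R] [Fintype Γ] in
/-- For an even `G` without constant part and an even `P` without constant part, `∂_Z ∂_Y (G P)` has no constant part. -/
theorem constPart_grassmannDeriv_grassmannDeriv_mul_eq_zero {G P : GrassmannAlgebra R Γ} (hG : G ∈ evenOdd R 0)
    (hG0 : constPart R G = 0) (hP : P ∈ evenOdd R 0) (hP0 : constPart R P = 0) (Y Z : Γ) [Fintype Γ] :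
    constPart R (grassmannDeriv R Z (grassmannDeriv R Y (G * P))) = 0 := by
  have hdY : grassmannDeriv R Y G ∈ evenOdd R (1 : ZMod 2) := by
    simpa using grassmannDeriv_mem_evenOdd R Y hG
  have hdZ : grassmannDeriv R Z G ∈ evenOdd R (1 : ZMod 2) := by
    simpa using grassmannDeriv_mem_evenOdd R Z hG
  rw [grassmannDeriv_mul_of_mem_evenOdd_zero R Y hG]
  -- move the odd factor `∂_Y G` to the right of the even (central) `P`
  have hcomm : grassmannDeriv R Y G * P = P * grassmannDeriv R Y G := ((commute_of_mem_evenOdd_zero R hP _).eq).symm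
  rw [hcomm, map_add, grassmannDeriv_mul_of_mem_evenOdd_zero R Z hP, grassmannDeriv_mul_of_mem_evenOdd_zero R Z hG]
  simp only [map_add, map_mul, constPart_eq_zero_of_mem_evenOdd_one R hdY, constPart_eq_zero_of_mem_evenOdd_one R hdZ,
    hG0, hP0, mul_zero, zero_mul, add_zero]

omit [DecidableEq Γ] [Algebra ℚ R] in
/-- For an even `G` without constant part and `k ≥ 2`, `∂_Z ∂_Y (G^k)` has no constant part. -/
theorem constPart_grassmannDeriv_grassmannDeriv_pow_eq_zero {G : GrassmannAlgebra R Γ} (hG : G ∈ evenOdd R 0)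
    (hG0 : constPart R G = 0) {k : ℕ} (hk : 2 ≤ k) (Y Z : Γ) :
    constPart R (grassmannDeriv R Z (grassmannDeriv R Y (G ^ k))) = 0 := by
  obtain ⟨j, rfl⟩ := Nat.exists_eq_add_of_le hk
  rw [show 2 + j = 1 + (j + 1) by ring, pow_add, pow_one]
  refine constPart_grassmannDeriv_grassmannDeriv_mul_eq_zero R hG hG0 (pow_mem_evenOdd_zero R hG _) ?_ Y Z
  rw [map_pow, hG0, zero_pow (Nat.succ_ne_zero j)]

omit [DecidableEq Γ] in
/-- **Only the linear term of `e^{-𝒢}` has a two-point coefficient**: for an even `G` without constant part,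
`constPart (∂_Z ∂_Y e^{-G}) = - constPart (∂_Z ∂_Y G)`. -/
theorem constPart_grassmannDeriv_grassmannDeriv_grassmannExp_neg {G : GrassmannAlgebra R Γ} (hG : G ∈ evenOdd R 0)
    (hG0 : constPart R G = 0) (Y Z : Γ) :
    constPart R (grassmannDeriv R Z (grassmannDeriv R Y (grassmannExp (-G)))) =
      -constPart R (grassmannDeriv R Z (grassmannDeriv R Y G)) := by
  have hG0' : constPart R (-G) = 0 := by rw [map_neg, hG0, neg_zero]
  obtain ⟨k, hk⟩ := isNilpotent_of_constPart_eq_zero R hG0'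
  have hk2 : (-G) ^ (k + 2) = 0 := by rw [pow_add, hk, zero_mul]
  rw [grassmannExp, IsNilpotent.exp_eq_sum hk2, Finset.sum_range_succ', Finset.sum_range_succ']
  simp only [map_add, map_sum, map_rat_smul]
  rw [Finset.sum_eq_zero (fun i _ => by
    rw [constPart_grassmannDeriv_grassmannDeriv_pow_eq_zero R (neg_mem hG) hG0' (by omega : 2 ≤ i + 1 + 1), smul_zero]),
    zero_add]
  simp [map_neg]

omit [Fintype Γ] [DecidableEq Γ] in
/-- The logarithm series of an even element is even. -/
theorem grassmannLog1p_mem_evenOdd_zero {x : GrassmannAlgebra R Γ} (hx : x ∈ evenOdd R 0) :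
    grassmannLog1p R x ∈ evenOdd R 0 := by
  rw [grassmannLog1p]
  exact Submodule.sum_mem _ fun k _ => Submodule.smul_mem _ _ (pow_mem_evenOdd_zero R hx k)

omit [DecidableEq Γ] in
/-- **The effective action of an even interaction without constant part is even** (any commutative `ℚ`-algebra of
coefficients; the tree's `effAction_mem_evenPart` is the `RCLike` case). -/
theorem effAction_mem_evenOdd_zero (C : Matrix Γ Γ R) {V : GrassmannAlgebra R Γ} (hV : V ∈ evenOdd R 0)
    (hV0 : constPart R V = 0) : effAction R C V ∈ evenOdd R 0 := by
  have hnV : IsNilpotent (-V) := isNilpotent_of_constPart_eq_zero R (by rw [map_neg, hV0, neg_zero])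
  have hexp : grassmannExp (-V) ∈ evenOdd R 0 := grassmannExp_mem_evenOdd_zero R (neg_mem hV) hnV
  have hB : effBoltzmann R C V ∈ evenOdd R 0 := by
    rw [effBoltzmann_def]; exact gaussConv_mem_evenOdd R C hexp
  rw [effAction_def]
  refine neg_mem (grassmannLog1p_mem_evenOdd_zero R ?_)
  exact sub_mem (Submodule.smul_mem _ _ hB) (one_mem_evenOdd_zero R)

/-- **The two-point function in terms of the effective action.**  For an even interaction `V` without constant part whose
normalised partition function `Z = ∫ dμ_C e^{-V}` is a unit:
`∫ dμ_C ψ(a) ψ(b) e^{-V} = Z · (A(a,b) + Σ_{Y,Z} A(a,Y) A(b,Z) constPart (∂_Z ∂_Y (effAction C V)))`. -/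
theorem gaussExpect_gen_mul_gen_mul_grassmannExp_neg (C : Matrix Γ Γ R) {V : GrassmannAlgebra R Γ}
    (hV : V ∈ evenOdd R 0) (hV0 : constPart R V = 0) (hZ : IsUnit (effPartitionFn R C V)) (a b : Γ) :
    gaussExpect R C (gen R a * gen R b * grassmannExp (-V)) =
      effPartitionFn R C V *
        (contr R C a b + ∑ Y, ∑ Z, contr R C a Y * contr R C b Z *
          constPart R (grassmannDeriv R Z (grassmannDeriv R Y (effAction R C V)))) := by
  rw [gaussExpect_gen_mul_gen_mul, ← effPartitionFn_eq_gaussExpect]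
  have hG : effAction R C V ∈ evenOdd R 0 := effAction_mem_evenOdd_zero R C hV hV0
  have hG0 : constPart R (effAction R C V) = 0 := constPart_effAction R C V hZ
  have hderiv : ∀ Y Z, gaussExpect R C (grassmannDeriv R Z (grassmannDeriv R Y (grassmannExp (-V)))) =
      -(effPartitionFn R C V * constPart R (grassmannDeriv R Z (grassmannDeriv R Y (effAction R C V)))) := by
    intro Y Z
    rw [gaussExpect_grassmannDeriv_grassmannDeriv, ← effBoltzmann_def, effBoltzmann_eq_smul_grassmannExp R C V hZ,
      map_smul, map_smul, map_smul,
      constPart_grassmannDeriv_grassmannDeriv_grassmannExp_neg R hG hG0, smul_eq_mul, mul_neg]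
  have hre : ∀ Y Z, contr R C a Y * contr R C b Z *
      -(effPartitionFn R C V * constPart R (grassmannDeriv R Z (grassmannDeriv R Y (effAction R C V)))) =
      -(effPartitionFn R C V * (contr R C a Y * contr R C b Z *
        constPart R (grassmannDeriv R Z (grassmannDeriv R Y (effAction R C V))))) := by
    intros; ring
  simp only [hderiv, hre, Finset.sum_neg_distrib, sub_neg_eq_add, ← Finset.mul_sum]
  ring

omit [Fintype Γ] [DecidableEq Γ] [Algebra ℚ R] in
/-- The two-point coefficient is the iterated derivative behind `kernel · 2`: `∂_Z ∂_Y G = iterDeriv ![Y, Z] G`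
(so `constPart (∂_Z ∂_Y G) = 2! · kernel G 2 ![Y, Z]`). -/
theorem grassmannDeriv_grassmannDeriv_eq_iterDeriv (G : GrassmannAlgebra R Γ) (Y Z : Γ) :
    grassmannDeriv R Z (grassmannDeriv R Y G) = iterDeriv R ![Y, Z] G := by
  simp [iterDeriv, List.ofFn_succ, Module.End.mul_apply]

end Summit.HubbardSuperconductivity.HubbardSuperconductivity.Theorems.TwoPointAssembly

end
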